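import Summits.Ventures.KdS.SpinFlipFrobenius
import HarnessLib

/-!
# Venture KdS — the doubly-resonant candidates, V: polynomial solutions of Heun's equation at
# `x = 0` satisfy T10's three-term recurrence (the rows of (1.1))

HONEST FRAMING (venture `Summits/Ventures/KdS`, cell `pub-kds`; optional kernel object of the
Monday S3 seat; general-Heun ANALYSIS in Umetsu's normalisation (`GeneralHeun.IsSolutionOn`),
nothing about Kerr–de Sitter — the `x = 0` twin of `SpinFlipFrobenius` (which expands at `x = 1`)).
T10 (`lit/Q3PRIME-CASES.md` §1) uses: a polynomial `u = Σ_{k≤d} c_k x^k` solving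
`x(x−1)(x−t)u″ + [γ(x−1)(x−t) + δx(x−t) + ε x(x−1)]u′ + (αβx + q)u = 0` has coefficients obeying
`q c_n = D_n c_n − t(n+1)(n+γ) c_{n+1} + (n−1+α)(d−n+1) c_{n−1}`, `D_n = n[(n−1+γ)(1+t) + δt + ε]`,
when `β = −d` and the Fuchs relation holds — i.e. `c` is an eigenvector of the matrix (1.1) of
`RouteWDoublyResonantTruncation` with eigenvalue `q`. This file proves exactly that:
* `powSum`, `powSum₁`, `powSum₂` (the polynomial and the closed forms of `u′`, `u″`;
  `hasDerivAt_powSum`, `hasDerivAt_powSum₁`);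
* `heunOp_monomial`: the operator on `x^k` is `Y₊(k)x^{k+1} + Y₀(k)x^k + Y₋(k)x^{k−1}` with
  `Y₊ = symX₂` (of `SpinFlipIntertwine`), `Y₀(k) = q − D_k`, `Y₋(k) = t k(k−1+γ)`;
* `heunOp_powSum`: `lead·u″ + mid·u′ + low·u = Σ_{n<d+2} opCoeff_n x^n` (regrouping by powers);
* `opCoeff_eq_zero_of_isSolutionOn`: along an interval of solution every `opCoeff_n` vanishes
  (a polynomial with infinitely many roots is zero, `coeff_eq_zero_of_sum_eval_eq_zero`);
* ★ `heun_truncation_rows`: under `γ+δ+ε = α+β+1` and `β = −d`, for `n ≤ d`,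
  `q c_n = D_n c_n − t(n+1)(n+γ)c_{n+1} + [n ≥ 1](n−1+α)(d−(n−1))c_{n−1}` — the rows of (1.1).
The identification of these rows with `truncMatrix.mulVec` and the assembly with
`re_lambdaBar_neg_of_re_nonneg` (Dictionary) are one-screen glue left for when the new modules'
oleans exist (hub build backlog at the time of writing). The F-homotopy `y = (z_r − x)^{1−ε}u`
(accessory shift `q = q′ + (1−ε)γ`) and the radial ↔ Heun equivalence are NOT typed here.
0 cited facts, no `sorry`.
-/

noncomputable section

open Set Complex Finset

namespace Summit.Ventures.KdS.RouteW.DoublyResonant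

open Literature.Analysis.ODE Literature.Analysis.ODE.GeneralHeun Summit.Ventures.KdS.SpinFlipTS

/-! ### §1. The polynomial and its derivatives -/

/-- `u(x) = Σ_{k<K} c_k x^k` (complex coefficients, real variable). -/
def powSum (c : ℕ → ℂ) (K : ℕ) (x : ℝ) : ℂ := ∑ k ∈ range K, c k * (x : ℂ) ^ k

/-- Closed form of `u′`: `Σ_{k<K} c_k·k·x^{k−1}`. -/
def powSum₁ (c : ℕ → ℂ) (K : ℕ) (x : ℝ) : ℂ := ∑ k ∈ range K, c k * ((k : ℂ) * (x : ℂ) ^ (k - 1))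

/-- Closed form of `u″`: `Σ_{k<K} c_k·k(k−1)·x^{k−2}`. -/
def powSum₂ (c : ℕ → ℂ) (K : ℕ) (x : ℝ) : ℂ :=
  ∑ k ∈ range K, c k * ((k : ℂ) * ((k : ℂ) - 1) * (x : ℂ) ^ (k - 2))

/-- `d/dx x^k = k x^{k−1}` for the complex power of a real variable. -/
private theorem hasDerivAt_ofReal_pow (k : ℕ) (x : ℝ) :
    HasDerivAt (fun y : ℝ => (y : ℂ) ^ k) ((k : ℂ) * (x : ℂ) ^ (k - 1)) x := by
  have h := (hasDerivAt_pow k (x : ℂ)).comp_ofReal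
  simpa using h

/-- `u′ = powSum₁`. -/
theorem hasDerivAt_powSum (c : ℕ → ℂ) (K : ℕ) (x : ℝ) :
    HasDerivAt (powSum c K) (powSum₁ c K x) x := by
  unfold powSum powSum₁
  exact HasDerivAt.fun_sum fun k _ => (hasDerivAt_ofReal_pow k x).const_mul (c k)

/-- `u″ = powSum₂`. -/
theorem hasDerivAt_powSum₁ (c : ℕ → ℂ) (K : ℕ) (x : ℝ) :
    HasDerivAt (powSum₁ c K) (powSum₂ c K x) x := by
  unfold powSum₁ powSum₂
  refine HasDerivAt.fun_sum fun k _ => ?_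
  have h := ((hasDerivAt_ofReal_pow (k - 1) x).const_mul (k : ℂ)).const_mul (c k)
  refine h.congr_deriv ?_
  rcases k with _ | k
  · simp
  · have e : k + 1 - 1 - 1 = k + 1 - 2 := by omega
    rw [e]
    push_cast
    ring

/-! ### §2. The operator on a monomial and on the polynomial -/

/-- `D_k := k[(k−1+γ)(1+t) + δt + ε]` (T10 (1.1), complex parameters). -/
def diagD (t γ δ ε : ℂ) (k : ℕ) : ℂ := (k : ℂ) * (((k : ℂ) - 1 + γ) * (1 + t) + δ * t + ε)

/-- `Y₋(k) := t·k·(k−1+γ)` (the coefficient of `x^{k−1}`; `Y₋(0) = 0`). -/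
def symLo (t γ : ℂ) (k : ℕ) : ℂ := t * (k : ℂ) * ((k : ℂ) - 1 + γ)

/-- **The operator on `x^k`**: for every `k` and `x`,
`k(k−1)·lead·x^{k−2} + k·mid·x^{k−1} + low·x^k = Y₊(k)x^{k+1} + (q − D_k)x^k + Y₋(k)x^{k−1}`
with `Y₊ = symX₂` (natural-number exponents; the `k = 0, 1` cases hold with `ℕ`-subtraction). -/
theorem heunOp_monomial (t α β γ δ ε q : ℂ) (k : ℕ) (x : ℝ) :
    lead t x * ((k : ℂ) * ((k : ℂ) - 1) * (x : ℂ) ^ (k - 2)) +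
        mid t γ δ ε x * ((k : ℂ) * (x : ℂ) ^ (k - 1)) + low α β q x * (x : ℂ) ^ k =
      symX₂ α β γ δ ε k * (x : ℂ) ^ (k + 1) + (q - diagD t γ δ ε k) * (x : ℂ) ^ k +
        symLo t γ k * (x : ℂ) ^ (k - 1) := by
  unfold lead mid low symX₂ diagD symLo
  rcases k with _ | _ | k
  · simp
  · simp; ring
  · have e1 : k + 1 + 1 - 2 = k := by omega
    have e2 : k + 1 + 1 - 1 = k + 1 := by omega
    rw [e1, e2]
    push_cast
    ring

/-- The regrouped coefficient of `x^n`: `opCoeff_n = Y₋(n+1)c_{n+1} + (q − D_n)c_n + Y₊(n−1)c_{n−1}`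
(no third term for `n = 0`). -/
def opCoeff (t α β γ δ ε q : ℂ) (c : ℕ → ℂ) (n : ℕ) : ℂ :=
  symLo t γ (n + 1) * c (n + 1) + (q - diagD t γ δ ε n) * c n +
    (if n = 0 then 0 else symX₂ α β γ δ ε ((n - 1 : ℕ) : ℂ) * c (n - 1))

/-- **The operator on the polynomial, regrouped by powers**: for `c` supported in `k ≤ d`,
`lead·u″ + mid·u′ + low·u = Σ_{n<d+2} opCoeff_n x^n`. -/
theorem heunOp_powSum (t α β γ δ ε q : ℂ) {c : ℕ → ℂ} {d : ℕ} (hc : ∀ k, d + 1 ≤ k → c k = 0)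
    (x : ℝ) :
    lead t x * powSum₂ c (d + 1) x + mid t γ δ ε x * powSum₁ c (d + 1) x +
        low α β q x * powSum c (d + 1) x =
      ∑ n ∈ range (d + 2), opCoeff t α β γ δ ε q c n * (x : ℂ) ^ n := by
  -- termwise
  have hterm : lead t x * powSum₂ c (d + 1) x + mid t γ δ ε x * powSum₁ c (d + 1) x +
      low α β q x * powSum c (d + 1) x =
      ∑ k ∈ range (d + 1), c k * (symX₂ α β γ δ ε k * (x : ℂ) ^ (k + 1) +
        (q - diagD t γ δ ε k) * (x : ℂ) ^ k + symLo t γ k * (x : ℂ) ^ (k - 1)) := by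
    unfold powSum powSum₁ powSum₂
    rw [mul_sum, mul_sum, mul_sum, ← sum_add_distrib, ← sum_add_distrib]
    refine sum_congr rfl fun k _ => ?_
    rw [← heunOp_monomial]
    ring
  rw [hterm]
  -- the three families
  set gP : ℕ → ℂ := fun k => c k * symX₂ α β γ δ ε k * (x : ℂ) ^ (k + 1) with hgP
  set gZ : ℕ → ℂ := fun k => c k * (q - diagD t γ δ ε k) * (x : ℂ) ^ k with hgZ
  set gM : ℕ → ℂ := fun k => c k * symLo t γ k * (x : ℂ) ^ (k - 1) with hgM
  have hsplit : ∑ k ∈ range (d + 1), c k * (symX₂ α β γ δ ε k * (x : ℂ) ^ (k + 1) +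
      (q - diagD t γ δ ε k) * (x : ℂ) ^ k + symLo t γ k * (x : ℂ) ^ (k - 1)) =
      ∑ k ∈ range (d + 1), gP k + ∑ k ∈ range (d + 1), gZ k + ∑ k ∈ range (d + 1), gM k := by
    rw [← sum_add_distrib, ← sum_add_distrib]
    exact sum_congr rfl fun k _ => by simp only [hgP, hgZ, hgM]; ring
  rw [hsplit]
  -- target families
  have hc1 : c (d + 1) = 0 := hc (d + 1) le_rfl
  have hc2 : c (d + 2) = 0 := hc (d + 2) (by omega)
  have hP : ∑ k ∈ range (d + 1), gP k =
      ∑ n ∈ range (d + 2),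
        (if n = 0 then 0 else symX₂ α β γ δ ε ((n - 1 : ℕ) : ℂ) * c (n - 1)) * (x : ℂ) ^ n := by
    rw [sum_range_succ'
      (fun n => (if n = 0 then 0 else symX₂ α β γ δ ε ((n - 1 : ℕ) : ℂ) * c (n - 1)) *
        (x : ℂ) ^ n) (d + 1)]
    simp only [Nat.succ_ne_zero, if_false, if_true, zero_mul, add_zero, Nat.add_sub_cancel]
    exact sum_congr rfl fun k _ => by simp only [hgP]; ring
  have hZ : ∑ k ∈ range (d + 1), gZ k =
      ∑ n ∈ range (d + 2), (q - diagD t γ δ ε n) * c n * (x : ℂ) ^ n := by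
    rw [sum_range_succ _ (d + 1), hc1, mul_zero, zero_mul, add_zero]
    exact sum_congr rfl fun k _ => by simp only [hgZ]; ring
  have hM : ∑ k ∈ range (d + 1), gM k =
      ∑ n ∈ range (d + 2), symLo t γ (n + 1) * c (n + 1) * (x : ℂ) ^ n := by
    rw [sum_range_succ' gM d]
    have h0 : gM 0 = 0 := by simp [hgM, symLo]
    rw [h0, add_zero, sum_range_succ _ (d + 1), sum_range_succ _ d, hc1, hc2]
    simp only [mul_zero, zero_mul, add_zero]
    exact sum_congr rfl fun k _ => by
      simp only [hgM, Nat.add_sub_cancel]; ring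
  rw [hP, hZ, hM, ← sum_add_distrib, ← sum_add_distrib]
  refine sum_congr rfl fun n _ => ?_
  unfold opCoeff
  ring

/-! ### §3. Solutions satisfy the recurrence -/

/-- Along an open interval of solution, the regrouped polynomial vanishes there. -/
theorem opSum_eq_zero_of_isSolutionOn {t α β γ δ ε q : ℂ} {c : ℕ → ℂ} {d : ℕ} {a b : ℝ}
    (hc : ∀ k, d + 1 ≤ k → c k = 0)
    (hsol : IsSolutionOn t α β γ δ ε q (Ioo a b) (powSum c (d + 1))) :
    ∀ x ∈ Ioo a b, ∑ n ∈ range (d + 2), opCoeff t α β γ δ ε q c n * (x : ℂ) ^ n = 0 := by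
  obtain ⟨f₁, f₂, h⟩ := hsol
  intro x hx
  obtain ⟨h1, h2, h3⟩ := h x hx
  have e1 : f₁ x = powSum₁ c (d + 1) x := h1.unique (hasDerivAt_powSum c (d + 1) x)
  have hev : f₁ =ᶠ[nhds x] powSum₁ c (d + 1) := by
    filter_upwards [isOpen_Ioo.mem_nhds hx] with y hy using
      (h y hy).1.unique (hasDerivAt_powSum c (d + 1) y)
  have e2 : f₂ x = powSum₂ c (d + 1) x :=
    (h2.congr_of_eventuallyEq hev.symm).unique (hasDerivAt_powSum₁ c (d + 1) x)
  rw [e1, e2, heunOp_powSum t α β γ δ ε q hc] at h3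
  exact h3

/-- **A polynomial solution satisfies the recurrence**: every `opCoeff_n` vanishes (`n < d+2`). -/
theorem opCoeff_eq_zero_of_isSolutionOn {t α β γ δ ε q : ℂ} {c : ℕ → ℂ} {d : ℕ} {a b : ℝ}
    (hab : a < b) (hc : ∀ k, d + 1 ≤ k → c k = 0)
    (hsol : IsSolutionOn t α β γ δ ε q (Ioo a b) (powSum c (d + 1))) :
    ∀ n, n < d + 2 → opCoeff t α β γ δ ε q c n = 0 :=
  coeff_eq_zero_of_sum_eval_eq_zero hab (opSum_eq_zero_of_isSolutionOn hc hsol)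

/-- ★ **The rows of T10's matrix (1.1).** If `u = Σ_{k≤d} c_k x^k` solves
`Hn(t; α, β; γ, δ, ε; q)` (Umetsu's sign of `q`) on a real interval, with the Fuchs relation and
`β = −d`, then for every `n ≤ d`:
`q·c_n = D_n·c_n − t(n+1)(n+γ)·c_{n+1} + [n ≥ 1]·(n−1+α)(d−(n−1))·c_{n−1}`. -/
theorem heun_truncation_rows {t α β γ δ ε q : ℂ} {c : ℕ → ℂ} {d : ℕ} {a b : ℝ} (hab : a < b)
    (hF : γ + δ + ε = α + β + 1) (hβ : β = -(d : ℂ)) (hc : ∀ k, d + 1 ≤ k → c k = 0)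
    (hsol : IsSolutionOn t α β γ δ ε q (Ioo a b) (powSum c (d + 1))) {n : ℕ} (hn : n ≤ d) :
    q * c n = diagD t γ δ ε n * c n - t * ((n : ℂ) + 1) * ((n : ℂ) + γ) * c (n + 1) +
      (if n = 0 then 0 else ((n : ℂ) - 1 + α) * ((d : ℂ) - ((n : ℂ) - 1)) * c (n - 1)) := by
  have h := opCoeff_eq_zero_of_isSolutionOn hab hc hsol n (by omega)
  unfold opCoeff at h
  rcases Nat.eq_zero_or_pos n with h0 | hpos
  · subst h0
    simp only [if_true, add_zero] at h ⊢
    unfold symLo at h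
    push_cast at h ⊢
    linear_combination h
  · have hne : n ≠ 0 := by omega
    rw [if_neg hne] at h ⊢
    rw [symX₂_eq_mul hF] at h
    have hcast : (((n - 1 : ℕ) : ℂ)) = (n : ℂ) - 1 := by
      rw [Nat.cast_sub (by omega)]; push_cast; ring
    rw [hcast, hβ] at h
    unfold symLo at h
    push_cast at h
    linear_combination h

end Summit.Ventures.KdS.RouteW.DoublyResonant
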